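import Summits.ResolutionOfSingularities.ResolutionOfSingularities.Theorems.MarkedTransferCampaignW46CuspStaircasePermissibleStep
import Summits.ResolutionOfSingularities.ResolutionOfSingularities.Theorems.MarkedTransferCampaignW46FiniteExitBound
import Summits.ResolutionOfSingularities.ResolutionOfSingularities.Theorems.MarkedTransferCampaignW46MohWindowCurveInstance
import HarnessLib

/-!
# [OURS · L1 W4.6, rung (iii)] The cusp staircase, XI — the GEOMETRIC rung: every §2.1-permissible blow-up sequence from a
# window / staircase state is finite, with explicit length; unconditionally so for K4.6's family `(𝔸²_K, ((y^p + xⁿ), p))`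
# (cell res-hironaka, LADDER-RESOLUTION rung L, D-0089; slot W4.6, seat res-L1-s46-pv-5 gen 3; host route MarkedTransfer,
# `--kind proof --supports stmt-ResolutionOfSingularities-16155 --as helper`)

HONEST FRAMING. Everything below is OURS: kernel theorems about the campaign definitions `CampaignW46.Regime.mohWindowCurve`
(p472581), `Regime.cuspCurve` (p482083), seat pv-1's résumé-free sequence types `PermissibleRun` / `FinPermissibleRun` /
`PermissiblyTerminates` / `FinLocalExitBound` (`…PermissibleReduction.lean`, `…FiniteExitBound.lean` p485314/p488284) and
seat pv-13's scheme-level instance `CuspPlane.regime_cuspCurve` (`…MohWindowCurveInstance.lean`). NOTHING here is a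
statement of H. Hironaka's manuscript *Resolution of singularities in positive characteristics* (2017-03-23,
[Hironaka2017]) and nothing here asserts that any statement of it holds; the manuscript enters only through the typed
CANDIDATE carriers of row 001 (`AmbientDatum`, `IdealExponent`, `sing`, `transform`, `IsPermissibleCentre`). No
FACT-LIST premise is used. AI review is weaker than expert review. No `sorry`; axioms standard.

## What is proved (every prime `p`, every field `K` of characteristic `p`)

RÉSUMÉ-FREE («geometric») forms of the curve rungs — no notion instance, no résumé, no reading; the INPUT alone is
constrained:
* `Cusp.transform_sing_finite_and_ncard_lt_of_mohWindowCurve`, `Cusp.transform_mohWindowCurve` — window one-step laws for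
  any §2.1-permissible point blow-up (the staircase ones are file X `…CuspStaircasePermissibleStep.lean`).
* `FinPermissibleRun.cuspCurve_of_zero` / `mohWindowCurve_of_zero` — the regimes propagate along finite permissible sequences;
  `FinPermissibleRun.sum_cuspMultiset_add_mul_le` — `Σ(E_k) + k·b ≤ Σ(E₀)`; `FinPermissibleRun.ncard_sing_add_le` —
  `#Sing(E_k) + k ≤ #Sing(E₀)` in the window.
* **`FinPermissibleRun.len_le_sum_div_of_cuspCurve`** — every finite §2.1-permissible sequence whose stage `0` is a
  staircase state has LENGTH `≤ Σ(E₀)/b`; **`FinPermissibleRun.len_le_ncard_of_mohWindowCurve`** — `≤ #Sing(E₀)` in the window.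
* **`PermissibleRun.not_cuspCurve_zero` / `not_mohWindowCurve_zero`** — NO infinite §2.1-permissible sequence starts at a
  staircase / window state; hence `permissiblyTerminates_cuspCurve`, `permissiblyTerminates_mohWindowCurve` (pv-1's
  `PermissiblyTerminates`, which re-derives `Terminates N Rd` for every `N`, `Rd` by `terminates_of_permissiblyTerminates`) and
  `finLocalExitBound_cuspCurve`, `finLocalExitBound_mohWindowCurve` (pv-1's rung-(i-a)′ shape `FinLocalExitBound` HOLDS on
  these two sub-regimes of `regimePlaneIsolated`, with `β(A, E, x) = Σ(E)/b`, resp. `#Sing(E)`).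
* **K4.6's family, unconditionally** (with pv-13's `CuspPlane.regime_cuspCurve`: `E_n = ((y^p + xⁿ)·𝒪, p)` on `𝔸²_K`,
  `p < n`, `p ∤ n`, IS a staircase state): `CuspPlane.sum_cuspMultiset_le` (`Σ(E_n) ≤ n`),
  **`CuspPlane.finPermissibleRun_len_le`** — every finite §2.1-permissible blow-up sequence starting at `(𝔸²_K, E_n)` has
  length `≤ n/p` (ATLAS-RUN j259568 «resolution length ⌊n/p⌋», now a kernel theorem about ALL permissible sequences);
  **`CuspPlane.permissibleRun_false`** — no infinite one exists; `CuspPlane.not_divergesFrom`, `CuspPlane.not_divergesFromNabla`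
  — the typed Th. 16.6 procedure (any `N`, `Rd`, inside any regime) admits no infinite run from `(𝔸²_K, E_n)`.

VACUITY: the `PermissibleRun` / `FinPermissibleRun` statements posit no résumé; the empty sequence (`len = 0`) and the
blow-up of the (K-rational, hence smooth) origin inhabit `FinPermissibleRun` at `(𝔸²_K, E_n)` — the latter is not
constructed here. Nothing is claimed for `b ∣ d`, for surfaces, or outside ambient embedding dimension `2` at the singular
points; the barrier `ResidualOrderUnboundedNarrow.mohStability_fails_for_each_e` (e ≥ 3) is not touched.

## References

* Seats pv-1 (`…PermissibleReduction.lean`, `…FiniteExitBound.lean`), pv-13 (`…MohWindowCurveInstance.lean`), this seat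
  (files I–X); RUNG-MAP-W46.md §RUNG (iii)/(i-a)′ (res-L1-type-o1); L/res-L0-k46/KILL-TEST-K4.6.md §4 (j258573, j259568).
* The Stacks Project, Tags 0804, 02OS, 01TB. [cite: StacksProject, Tag 0804]
* H. Hironaka, ms. 2017-03-23, §2.1 p.4 l.35–39, Def. 2.1 p.5 l.2–3, Th. 16.13 p.87 l.26–28 — scope only, under
  adjudication, not cited as fact. [Hironaka2017]
-/

noncomputable section

set_option linter.dupNamespace false -- mandated namespace of this single-conjunct summit

open CategoryTheory AlgebraicGeometry TopologicalSpace IsLocalRing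

namespace Summit.ResolutionOfSingularities.ResolutionOfSingularities.Theorems

namespace CampaignW46

open Literature.AlgebraicGeometry.Resolution
open Literature.AlgebraicGeometry.Hironaka2017.S02Preliminaries
open Literature.AlgebraicGeometry.Hironaka2017.Datum
open Scheme.IdealSheafData

universe u

/-! ## The window one-step laws, résumé-free -/

namespace Cusp

section PermissibleStep

variable {p : ℕ} [Fact p.Prime] {K : Type u} [Field K] [CharP K p]
variable {A A' : AmbientDatum p K} {E : IdealExponent A.Z} {D : Closeds A.Z} {π : A'.Z ⟶ A.Z}

/-- **In the window `#Sing` drops, résumé-free**: for a window state and the permissible blow-up of an irreducible closed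
`D ⊆ Sing(E)`, `Sing(E′)` is finite and `#Sing(E′) < #Sing(E)` (no singular point over the centre:
`MohWindow.idealOrder_controlledTransform_lt`). [folklore] -/
theorem transform_sing_finite_and_ncard_lt_of_mohWindowCurve (hπ : IsBlowup π (vanishingIdeal D))
    (hRg : Regime.mohWindowCurve A E) (hDirr : IsIrreducible (D : Set A.Z)) (hDS : (D : Set A.Z) ⊆ E.sing) :
    (E.transform π D).sing.Finite ∧ (E.transform π D).sing.ncard < E.sing.ncard := by
  classical
  obtain ⟨ξ, hξS, hξcl, hDξ⟩ := exists_eq_singleton_of_subset_sing hRg.2.1 hDirr hDS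
  obtain ⟨hfin, -, hwin⟩ := hRg
  haveI : IsLocallyNoetherian A'.Z := by
    haveI := A'.smooth
    exact LocallyOfFiniteType.isLocallyNoetherian A'.hom
  have hmaps : ∀ x' ∈ (E.transform π D).sing, π.base x' ∈ E.sing \ {ξ} := by
    intro x' hx'
    have hx'b : (E.b : ℕ∞) ≤ idealOrder (controlledTransform π (vanishingIdeal D) E.J E.b) x' := hx'
    have hne : π.base x' ≠ ξ := by
      intro heq
      have hY : stalkIdeal (vanishingIdeal D) (π.base x') = maximalIdeal (A.Z.presheaf.stalk (π.base x')) := by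
        apply stalkIdeal_vanishingIdeal_eq_maximalIdeal_of_closure_eq
        rw [hDξ, heq, hξcl.closure_eq]
      have hW : MohWindowAt E.b (A.Z.presheaf.stalk (π.base x')) (stalkIdeal E.J (π.base x')) :=
        hwin _ (heq ▸ hξS)
      have hlt := MohWindow.idealOrder_controlledTransform_lt hπ hY hW
      exact (not_le.mpr hlt) hx'b
    exact ⟨(transform_mem_sing_and_cuspIndexAt_eq_of_ne hπ hDξ hx' hne).1, hne⟩
  have hinj : Set.InjOn π.base (E.transform π D).sing := by
    refine (MohWindow.injOn_preimage_compl hπ).mono fun x' hx' => ?_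
    show π.base x' ∈ (D : Set A.Z)ᶜ
    rw [hDξ]
    exact (hmaps x' hx').2
  have hsub : E.sing \ {ξ} ⊆ E.sing := fun _ hx => hx.1
  have hmt : Set.MapsTo π.base (E.transform π D).sing (E.sing \ {ξ}) := fun x' hx' => hmaps x' hx'
  have hfin' : (E.transform π D).sing.Finite :=
    Set.Finite.of_finite_image ((hfin.subset hsub).subset hmt.image_subset) hinj
  have hle : (E.transform π D).sing.ncard ≤ (E.sing \ {ξ}).ncard :=
    Set.ncard_le_ncard_of_injOn π.base hmt hinj (hfin.subset hsub)
  have hdiff : (E.sing \ {ξ}).ncard = E.sing.ncard - 1 := Set.ncard_sdiff_singleton_of_mem hξS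
  have hpos : 0 < E.sing.ncard := (Set.ncard_pos hfin).mpr ⟨ξ, hξS⟩
  exact ⟨hfin', by omega⟩


/-- [OURS · L1 W4.6 rung (iii); NOT a statement of the manuscript] **The window regime is stable under every
§2.1-permissible blow-up**, résumé-free: for a window state `(A, E)`, an irreducible closed `D ⊆ Sing(E)` and the blow-up
`π` along its reduced ideal, `(A′, E.transform π D)` is a window state (all its singular points lie off the centre).
[folklore] -/
theorem transform_mohWindowCurve (hπ : IsBlowup π (vanishingIdeal D)) (hRg : Regime.mohWindowCurve A E)
    (hDirr : IsIrreducible (D : Set A.Z)) (hDS : (D : Set A.Z) ⊆ E.sing) :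
    Regime.mohWindowCurve A' (E.transform π D) := by
  classical
  obtain ⟨ξ, hξS, hξcl, hDξ⟩ := exists_eq_singleton_of_subset_sing hRg.2.1 hDirr hDS
  have hfin' := (transform_sing_finite_and_ncard_lt_of_mohWindowCurve hπ hRg hDirr hDS).1
  obtain ⟨-, hcl, hwin⟩ := hRg
  haveI : IsLocallyNoetherian A'.Z := by
    haveI := A'.smooth
    exact LocallyOfFiniteType.isLocallyNoetherian A'.hom
  have hne : ∀ x' ∈ (E.transform π D).sing, π.base x' ≠ ξ := by
    intro x' hx' heq
    have hY : stalkIdeal (vanishingIdeal D) (π.base x') = maximalIdeal (A.Z.presheaf.stalk (π.base x')) := by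
      apply stalkIdeal_vanishingIdeal_eq_maximalIdeal_of_closure_eq
      rw [hDξ, heq, hξcl.closure_eq]
    have hW : MohWindowAt E.b (A.Z.presheaf.stalk (π.base x')) (stalkIdeal E.J (π.base x')) :=
      hwin _ (heq ▸ hξS)
    have hlt := MohWindow.idealOrder_controlledTransform_lt hπ hY hW
    have hx'b : (E.b : ℕ∞) ≤ idealOrder (controlledTransform π (vanishingIdeal D) E.J E.b) x' := hx'
    exact (not_le.mpr hlt) hx'b
  refine ⟨hfin', fun x' hx' => ?_, fun x' hx' => ?_⟩
  · exact transform_isClosed_singleton_of_ne hπ hDξ (hne x' hx')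
      (hcl (transform_mem_sing_and_cuspIndexAt_eq_of_ne hπ hDξ hx' (hne x' hx')).1)
  · exact (transform_germ_of_ne hπ hDξ (hne x' hx')).2
      (hwin _ (transform_mem_sing_and_cuspIndexAt_eq_of_ne hπ hDξ hx' (hne x' hx')).1)

end PermissibleStep

end Cusp

/-! ## Finite permissible sequences from a staircase / window state -/

section Runs

variable {p : ℕ} [Fact p.Prime] {K : Type u} [Field K] [CharP K p]

namespace FinPermissibleRun

variable (r : FinPermissibleRun p K)

/-- The exponent `b` is constant along the meaningful stages of a finite permissible sequence. [folklore] -/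
theorem b_eq_of_le : ∀ k, k ≤ r.len → (r.E k).b = (r.E 0).b
  | 0, _ => rfl
  | k + 1, hk => by
    have h : (r.E (k + 1)).b = ((r.E k).transform (r.π k) (r.D k)).b := congrArg IdealExponent.b (r.E_succ k hk)
    rw [h, ← b_eq_of_le k (Nat.le_of_succ_le hk)]
    rfl

/-- [OURS · L1 W4.6 rung (iii); NOT a statement of the manuscript] Along a finite §2.1-permissible sequence the staircase
regime at stage `0` forces it at every stage `k ≤ len` (`Cusp.transform_cuspCurve`). [folklore] -/
theorem cuspCurve_of_zero (h0 : Regime.cuspCurve (p := p) (K := K) (r.A 0) (r.E 0)) :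
    ∀ k, k ≤ r.len → Regime.cuspCurve (p := p) (K := K) (r.A k) (r.E k)
  | 0, _ => h0
  | k + 1, hk => by
    have hk' : k < r.len := hk
    rw [r.E_succ k hk']
    exact Cusp.transform_cuspCurve (r.blowup k hk') (r.hom_eq k hk') (cuspCurve_of_zero h0 k hk'.le)
      (r.permissible k hk').irreducible (r.permissible k hk').subset_sing

/-- [OURS · L1 W4.6 rung (iii); NOT a statement of the manuscript] The same for the window regime
(`Cusp.transform_mohWindowCurve`). [folklore] -/
theorem mohWindowCurve_of_zero (h0 : Regime.mohWindowCurve (p := p) (K := K) (r.A 0) (r.E 0)) :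
    ∀ k, k ≤ r.len → Regime.mohWindowCurve (p := p) (K := K) (r.A k) (r.E k)
  | 0, _ => h0
  | k + 1, hk => by
    have hk' : k < r.len := hk
    rw [r.E_succ k hk']
    exact Cusp.transform_mohWindowCurve (r.blowup k hk') (mohWindowCurve_of_zero h0 k hk'.le)
      (r.permissible k hk').irreducible (r.permissible k hk').subset_sing

/-- [OURS · L1 W4.6 rung (iii); NOT a statement of the manuscript] **The total cusp index pays `b` per blow-up**: along a
finite §2.1-permissible sequence from a staircase state, `Σ(E_k) + k·b ≤ Σ(E₀)` for every `k ≤ len`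
(`Cusp.transform_sum_cuspMultiset_add_le`). [folklore] -/
theorem sum_cuspMultiset_add_mul_le (h0 : Regime.cuspCurve (p := p) (K := K) (r.A 0) (r.E 0)) :
    ∀ k, k ≤ r.len → (cuspMultiset (r.E k)).sum + k * (r.E 0).b ≤ (cuspMultiset (r.E 0)).sum
  | 0, _ => by simp
  | k + 1, hk => by
    have hk' : k < r.len := hk
    have hstep := Cusp.transform_sum_cuspMultiset_add_le (r.blowup k hk') (r.cuspCurve_of_zero h0 k hk'.le)
      (r.permissible k hk').irreducible (r.permissible k hk').subset_sing
    rw [← r.E_succ k hk', r.b_eq_of_le k hk'.le] at hstep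
    have ih := sum_cuspMultiset_add_mul_le h0 k hk'.le
    rw [Nat.succ_mul]
    omega

/-- [OURS · L1 W4.6 rung (iii); NOT a statement of the manuscript] **`#Sing` pays `1` per blow-up in the window**: along a
finite §2.1-permissible sequence from a window state, `#Sing(E_k) + k ≤ #Sing(E₀)` for every `k ≤ len`. [folklore] -/
theorem ncard_sing_add_le (h0 : Regime.mohWindowCurve (p := p) (K := K) (r.A 0) (r.E 0)) :
    ∀ k, k ≤ r.len → (r.E k).sing.ncard + k ≤ (r.E 0).sing.ncard
  | 0, _ => by simp
  | k + 1, hk => by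
    have hk' : k < r.len := hk
    have hstep := (Cusp.transform_sing_finite_and_ncard_lt_of_mohWindowCurve (r.blowup k hk')
      (r.mohWindowCurve_of_zero h0 k hk'.le) (r.permissible k hk').irreducible (r.permissible k hk').subset_sing).2
    rw [← r.E_succ k hk'] at hstep
    have ih := ncard_sing_add_le h0 k hk'.le
    omega

/-- [OURS · L1 W4.6 rung (iii); NOT a statement of the manuscript] **THE GEOMETRIC STAIRCASE RUNG, effective form**: every
finite §2.1-permissible blow-up sequence whose stage `0` is a staircase state `(A₀, E₀)` has length at most `Σ(E₀)/b`
(`Σ` = total cusp index `Multiset.sum (cuspMultiset E₀)`, `b = E₀.b`). No résumé, no notion instance. [folklore] -/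
theorem len_le_sum_div_of_cuspCurve (h0 : Regime.cuspCurve (p := p) (K := K) (r.A 0) (r.E 0)) :
    r.len ≤ (cuspMultiset (r.E 0)).sum / (r.E 0).b := by
  have h := r.sum_cuspMultiset_add_mul_le h0 r.len le_rfl
  exact (Nat.le_div_iff_mul_le h0.1).mpr (by omega)

/-- [OURS · L1 W4.6 rung (iii); NOT a statement of the manuscript] **THE GEOMETRIC WINDOW RUNG, effective form**: every
finite §2.1-permissible blow-up sequence whose stage `0` is a window state has length at most `#Sing(E₀)`. [folklore] -/
theorem len_le_ncard_of_mohWindowCurve (h0 : Regime.mohWindowCurve (p := p) (K := K) (r.A 0) (r.E 0)) :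
    r.len ≤ (r.E 0).sing.ncard := by
  have h := r.ncard_sing_add_le h0 r.len le_rfl
  omega

end FinPermissibleRun

namespace PermissibleRun

variable (r : PermissibleRun p K)

/-- [OURS · L1 W4.6 rung (iii); NOT a statement of the manuscript] **No infinite §2.1-permissible blow-up sequence starts
at a staircase state** (truncate at `Σ(E₀)/b + 1` and apply `FinPermissibleRun.len_le_sum_div_of_cuspCurve`). [folklore] -/
theorem not_cuspCurve_zero : ¬ Regime.cuspCurve (p := p) (K := K) (r.A 0) (r.E 0) := fun h0 => by
  have h := (r.truncate ((cuspMultiset (r.E 0)).sum / (r.E 0).b + 1)).len_le_sum_div_of_cuspCurve h0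
  change (cuspMultiset (r.E 0)).sum / (r.E 0).b + 1 ≤ (cuspMultiset (r.E 0)).sum / (r.E 0).b at h
  omega

/-- [OURS · L1 W4.6 rung (iii); NOT a statement of the manuscript] **No infinite §2.1-permissible blow-up sequence starts
at a window state** (a window state with a permissible centre is singular, hence a staircase state,
`Regime.cuspCurve_of_mohWindowCurve`). [folklore] -/
theorem not_mohWindowCurve_zero : ¬ Regime.mohWindowCurve (p := p) (K := K) (r.A 0) (r.E 0) := fun h0 =>
  r.not_cuspCurve_zero (Regime.cuspCurve_of_mohWindowCurve h0
    ((r.permissible 0).irreducible.nonempty.mono (r.permissible 0).subset_sing))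

end PermissibleRun

/-- [OURS · L1 W4.6 rung (iii); NOT a statement of the manuscript] **`PermissiblyTerminates Regime.cuspCurve`** (pv-1's
résumé-free termination shape) — by stage `0` alone. With pv-1's `terminates_of_permissiblyTerminates` this re-derives
`Terminates N Rd Regime.cuspCurve` for every `N`, `Rd` (this seat's `cuspCurveTerminates_holds`). [folklore] -/
theorem permissiblyTerminates_cuspCurve : PermissiblyTerminates (Regime.cuspCurve (p := p) (K := K)) :=
  fun r hr => r.not_cuspCurve_zero (hr 0)

/-- [OURS · L1 W4.6 rung (iii); NOT a statement of the manuscript] **`PermissiblyTerminates Regime.mohWindowCurve`.**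
[folklore] -/
theorem permissiblyTerminates_mohWindowCurve : PermissiblyTerminates (Regime.mohWindowCurve (p := p) (K := K)) :=
  fun r hr => r.not_mohWindowCurve_zero (hr 0)

/-- [OURS · L1 W4.6 rung (iii); NOT a statement of the manuscript] **pv-1's rung-(i-a)′ shape `FinLocalExitBound` HOLDS on
the staircase sub-regime**, with `β(A, E, x) := Σ(E)/E.b` (independent of `x`): the indices of the centres of a finite
permissible sequence in the regime form a subset of `{0, …, len − 1}` and `len ≤ Σ(E₀)/b`. [folklore] -/
theorem finLocalExitBound_cuspCurve : FinLocalExitBound (Regime.cuspCurve (p := p) (K := K)) := by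
  refine ⟨fun _ E _ => (cuspMultiset E).sum / E.b, fun r hr x s hs => ?_⟩
  have hlen := r.len_le_sum_div_of_cuspCurve (hr 0 (Nat.zero_le _))
  have hcard : s.card ≤ r.len := by
    calc s.card ≤ (Finset.range r.len).card :=
          Finset.card_le_card fun m hm => Finset.mem_range.mpr (hs m hm).1
      _ = r.len := Finset.card_range _
  exact hcard.trans hlen

/-- [OURS · L1 W4.6 rung (iii); NOT a statement of the manuscript] **`FinLocalExitBound` HOLDS on the window sub-regime**,
with `β(A, E, x) := #Sing(E)`. [folklore] -/
theorem finLocalExitBound_mohWindowCurve : FinLocalExitBound (Regime.mohWindowCurve (p := p) (K := K)) := by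
  refine ⟨fun _ E _ => E.sing.ncard, fun r hr x s hs => ?_⟩
  have hlen := r.len_le_ncard_of_mohWindowCurve (hr 0 (Nat.zero_le _))
  have hcard : s.card ≤ r.len := by
    calc s.card ≤ (Finset.range r.len).card :=
          Finset.card_le_card fun m hm => Finset.mem_range.mpr (hs m hm).1
      _ = r.len := Finset.card_range _
  exact hcard.trans hlen

end Runs

/-! ## K4.6's family `E_n = ((y^p + xⁿ)·𝒪, p)` on `𝔸²_K`, unconditionally -/

namespace CuspPlane

open MvPolynomial
open Literature.AlgebraicGeometry.Hironaka2017.SpecOrders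
open Literature.AlgebraicGeometry.Hironaka2017.S16Proof

variable (p : ℕ) [Fact p.Prime] (K : Type u) [Field K] [CharP K p]

/-- [OURS · L1 W4.6 rung (iii); NOT a statement of the manuscript] **`Σ(E_n) ≤ n`**: the total cusp index of K4.6's state
`(𝔸²_K, E_n)`, `p < n`, `p ∤ n`, is the cusp index of its one singular point, the origin (pv-13 `CuspPlane.sing_eq`), which
is at most the admissible exponent `n` (pv-13 `CuspPlane.cuspShape_ξ`, `Cusp.cuspIndex_le`). [folklore] -/
theorem sum_cuspMultiset_le {n : ℕ} (hpn : p < n) (hn : ¬ p ∣ n) :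
    (cuspMultiset (⟨shf (MvPolynomial (Fin 2) K) (Ideal.span {X 1 ^ p + X 0 ^ n}), p⟩ :
      IdealExponent (U82Gap.amb p K).Z)).sum ≤ n := by
  classical
  have hRg := regime_cuspCurve p K hpn hn
  have hfin := hRg.2.1
  have hmem : ∀ z ∈ hfin.toFinset, z = U82Gap.ξ K := fun z hz =>
    (mem_sing_iff p K hpn.le hn z).mp ((Set.Finite.mem_toFinset hfin).mp hz)
  rw [cuspMultiset_eq _ hfin, ← Finset.sum_eq_multiset_sum]
  calc ∑ z ∈ hfin.toFinset, cuspIndexAt _ z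
      ≤ ∑ z ∈ ({U82Gap.ξ K} : Finset (U82Gap.amb p K).Z), cuspIndexAt
          (⟨shf (MvPolynomial (Fin 2) K) (Ideal.span {X 1 ^ p + X 0 ^ n}), p⟩ :
            IdealExponent (U82Gap.amb p K).Z) z :=
        Finset.sum_le_sum_of_subset fun z hz => Finset.mem_singleton.mpr (hmem z hz)
    _ = cuspIndexAt (⟨shf (MvPolynomial (Fin 2) K) (Ideal.span {X 1 ^ p + X 0 ^ n}), p⟩ :
            IdealExponent (U82Gap.amb p K).Z) (U82Gap.ξ K) := Finset.sum_singleton _ _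
    _ ≤ n := Cusp.cuspIndex_le hn (cuspShape_ξ p K n)

/-- [OURS · L1 W4.6 rung (iii); NOT a statement of the manuscript] **Every finite §2.1-permissible blow-up sequence starting
at K4.6's state `(𝔸²_K, E_n)`, `p < n`, `p ∤ n`, has length at most `n/p`** — for every prime `p` and every field `K` of
characteristic `p`; no résumé, no notion instance, no regime hypothesis beyond the input (ATLAS-RUN j259568's «resolution
length ⌊n/p⌋» as a kernel bound on ALL permissible sequences). The start is stated as an equality of states (dependent
pairs). [folklore] -/
theorem finPermissibleRun_len_le {n : ℕ} (hpn : p < n) (hn : ¬ p ∣ n) (r : FinPermissibleRun p K)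
    (h0 : (⟨r.A 0, r.E 0⟩ : Σ A : AmbientDatum p K, IdealExponent A.Z) =
      ⟨U82Gap.amb p K, ⟨shf (MvPolynomial (Fin 2) K) (Ideal.span {X 1 ^ p + X 0 ^ n}), p⟩⟩) :
    r.len ≤ n / p := by
  have key : ∀ s t : Σ A : AmbientDatum p K, IdealExponent A.Z, s = t →
      Regime.cuspCurve (p := p) (K := K) t.1 t.2 →
        Regime.cuspCurve (p := p) (K := K) s.1 s.2 ∧
          (cuspMultiset s.2).sum / s.2.b = (cuspMultiset t.2).sum / t.2.b := by
    rintro s t rfl h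
    exact ⟨h, rfl⟩
  obtain ⟨h0Rg, hq⟩ := key _ _ h0 (regime_cuspCurve p K hpn hn)
  have h1 := r.len_le_sum_div_of_cuspCurve h0Rg
  have h2 : (cuspMultiset (r.E 0)).sum / (r.E 0).b ≤ n / p := by
    have hq' : (cuspMultiset (r.E 0)).sum / (r.E 0).b =
        (cuspMultiset (⟨shf (MvPolynomial (Fin 2) K) (Ideal.span {X 1 ^ p + X 0 ^ n}), p⟩ :
          IdealExponent (U82Gap.amb p K).Z)).sum / p := hq
    rw [hq']
    exact Nat.div_le_div_right (sum_cuspMultiset_le p K hpn hn)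
  exact h1.trans h2

/-- [OURS · L1 W4.6 rung (iii); NOT a statement of the manuscript] **No infinite §2.1-permissible blow-up sequence starts at
K4.6's state `(𝔸²_K, E_n)`**, `p < n`, `p ∤ n`. [folklore] -/
theorem permissibleRun_false {n : ℕ} (hpn : p < n) (hn : ¬ p ∣ n) (r : PermissibleRun p K)
    (h0 : (⟨r.A 0, r.E 0⟩ : Σ A : AmbientDatum p K, IdealExponent A.Z) =
      ⟨U82Gap.amb p K, ⟨shf (MvPolynomial (Fin 2) K) (Ideal.span {X 1 ^ p + X 0 ^ n}), p⟩⟩) : False := by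
  have key : ∀ s t : Σ A : AmbientDatum p K, IdealExponent A.Z, s = t →
      Regime.cuspCurve (p := p) (K := K) t.1 t.2 → Regime.cuspCurve (p := p) (K := K) s.1 s.2 := by
    rintro s t rfl h
    exact h
  exact r.not_cuspCurve_zero (key _ _ h0 (regime_cuspCurve p K hpn hn))

/-- [OURS · L1 W4.6 rung (iii); NOT a statement of the manuscript] **The typed Th. 16.6 procedure admits no infinite run from
K4.6's state `(𝔸²_K, E_n)`**, `p < n`, `p ∤ n` — for EVERY notion instance `N`, EVERY reading `Rd` and inside EVERY regime
`Rg` (`¬ DivergesFrom`; this seat's `not_divergesFrom_of_cuspCurve` at pv-13's instance). [folklore] -/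
theorem not_divergesFrom {n ν : ℕ} (hpn : p < n) (hn : ¬ p ∣ n) (N : Notions.{u} ν) (Rd : Reading p K N)
    (Rg : Regime p K) :
    ¬ DivergesFrom N Rd Rg (U82Gap.amb p K)
      ⟨shf (MvPolynomial (Fin 2) K) (Ideal.span {X 1 ^ p + X 0 ^ n}), p⟩ :=
  not_divergesFrom_of_cuspCurve N Rd Rg (regime_cuspCurve p K hpn hn)

/-- [OURS · L1 W4.6 rung (iii); NOT a statement of the manuscript] The same for the ∇-centred procedure
(`¬ DivergesFromNabla`). [folklore] -/
theorem not_divergesFromNabla {n ν : ℕ} (hpn : p < n) (hn : ¬ p ∣ n) (N : Notions.{u} ν) (Rd : Reading p K N)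
    (Rg : Regime p K) :
    ¬ DivergesFromNabla N Rd Rg (U82Gap.amb p K)
      ⟨shf (MvPolynomial (Fin 2) K) (Ideal.span {X 1 ^ p + X 0 ^ n}), p⟩ :=
  not_divergesFromNabla_of_cuspCurve N Rd Rg (regime_cuspCurve p K hpn hn)

end CuspPlane

end CampaignW46

end Summit.ResolutionOfSingularities.ResolutionOfSingularities.Theorems

end
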